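import Summits.ABC.StewartYu.SatBasisReduced
import HarnessLib

/-!
# The TRIANGULAR reduced saturated basis (I) — p1's `exists_reduced_satFrame` with the Hermite (upper) triangularity kept

Support file (theorems only; no named facts, no definitions). Cell `abc-stewartyu`, route `YuMatveevShapeRat` (A1.L), crux r2 `ArchCoreRat`
(stmt-ABC-20502); seat p5 g9 (STATUS 2026-08-27 ~20:58Z DESIGN FINDING: the θ-charged directional atoms `Σₖ Aₖ·Γₖ` and `YC` of the
archimedean packs are affordable only on a weight-sorted lower-triangular saturated basis with the pivot at the heaviest coordinate).
p1's `SatBasisReduced.exists_reduced_satFrame` discards the triangularity that `LatticeRows.exists_reduced_rows` provides (`H i j = 0` for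
`j < i`, `0 < H i i`); here it is KEPT (`exists_unimodular_reduce_tri`, `exists_reduced_frame_tri`, `exists_reduced_satFrame_upper` = p1's
three theorems verbatim plus the two conjuncts; proofs copy-adapted, p1's file untouched), giving the UPPER-triangular reduced saturated frame **`exists_reduced_satFrame_upper`** (`Uᵢⱼ = 0` for `j < i`, `0 < Uᵢᵢ`). The sequel
`SatBasisReducedLower` applies it to the reversed datum `α ∘ Fin.rev` and un-reverses, giving the weight-sorted LOWER-triangular frame
`exists_reduced_satFrame_lower` in the datum's own (weight-increasing) indexing.

WHAT THIS IS NOT: no change to `SatBasisReduced`/`LatticeReducedRows`; no START; no crux moves.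

## References
* [Cassels1997] J. W. S. Cassels, *An Introduction to the Geometry of Numbers*, Ch. I §2.2 Thm I (triangular bases of a lattice).
* [Nesterenko2003] Yu. V. Nesterenko, LNM 1819 (2003) — §3.4–3.5 (the lattice `𝔑` and its basis), §2 (weights sorted `A₁ ≤ … ≤ Aₙ`).
-/

namespace Summit.ABC.StewartYu

namespace SatBasisReduced

open Finset Matrix
open scoped Nat

variable {n : ℕ}

/-! ### p1's chain with the triangularity kept -/

/-- **Unimodular reduction, triangular form kept.** If `C·U = N·1` (`N ≥ 1`) there are integer matrices `P, Q` with `P·Q = 1 = Q·P`,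
`0 ≤ (P·U) i j ≤ N`, `(P·U) i j = 0` for `j < i` (upper-triangular rows) and `0 < (P·U) i i`. [cite: Cassels1997, Ch. I §2.2 Thm I] -/
theorem exists_unimodular_reduce_tri (N : ℕ) (hN : 0 < N) (C U : Matrix (Fin n) (Fin n) ℤ)
    (hCU : C * U = (N : ℤ) • (1 : Matrix (Fin n) (Fin n) ℤ)) :
    ∃ P Q : Matrix (Fin n) (Fin n) ℤ, P * Q = 1 ∧ Q * P = 1 ∧ (∀ i j, 0 ≤ (P * U) i j ∧ (P * U) i j ≤ N) ∧
      (∀ i j : Fin n, (j : ℕ) < i → (P * U) i j = 0) ∧ (∀ i, 0 < (P * U) i i) := by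
  classical
  -- the row lattice of `U`
  set Λ : AddSubgroup (Fin n → ℤ) := (Matrix.vecMulLinear U).toAddMonoidHom.range with hΛ
  have hmemΛ : ∀ x, x ∈ Λ ↔ ∃ c : Fin n → ℤ, c ᵥ* U = x := fun x => by
    simp [hΛ, AddMonoidHom.mem_range]
  -- `N·eⱼ = (row j of C) ᵥ* U ∈ Λ`
  have hsingle : ∀ j, Pi.single j (N : ℤ) ∈ Λ := by
    intro j
    refine (hmemΛ _).mpr ⟨C j, ?_⟩
    have h := row_mul_eq_vecMul C U j
    rw [hCU] at h
    rw [← h]; funext k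
    simp [Matrix.smul_apply, Matrix.one_apply, Pi.single_apply, eq_comm]
  obtain ⟨H, hHmem, hHbox, hHtri, hHdiag, hgen⟩ := LatticeRows.exists_reduced_rows Λ hN hsingle
  -- `H = P·U`
  choose p hp using fun i => (hmemΛ (H i)).mp (hHmem i)
  -- `U = Q·H`
  choose q hq using fun k => hgen (U k) ((hmemΛ _).mpr ⟨Pi.single k 1, by funext j; simp [Matrix.vecMul, dotProduct, Pi.single_apply]⟩)
  set P : Matrix (Fin n) (Fin n) ℤ := Matrix.of p with hPdef
  set Q : Matrix (Fin n) (Fin n) ℤ := Matrix.of q with hQdef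
  have hPU : P * U = H := by
    funext i; rw [row_mul_eq_vecMul]; exact hp i
  have hQH : Q * H = U := by
    funext k; rw [row_mul_eq_vecMul]; exact (hq k).symm
  -- `det U ≠ 0`
  have hdetU : U.det ≠ 0 := by
    intro h0
    have h := congrArg Matrix.det hCU
    rw [Matrix.det_mul, h0, mul_zero, Matrix.det_smul, Matrix.det_one, mul_one, Fintype.card_fin] at h
    exact pow_ne_zero _ (by exact_mod_cast hN.ne') h.symm
  -- `(Q·P − 1)·U = 0 ⇒ Q·P = 1`, then `P·Q = 1`
  have hQP : Q * P = 1 := by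
    have h1 : (Q * P) * U = U := by rw [Matrix.mul_assoc, hPU, hQH]
    have h2 : (Q * P - 1) * U = 0 := by rw [Matrix.sub_mul, h1, Matrix.one_mul, sub_self]
    have h3 : Q * P - 1 = 0 := by
      funext i
      have hrow : (Q * P - 1) i ᵥ* U = 0 := by
        rw [← row_mul_eq_vecMul, h2]; rfl
      exact Matrix.eq_zero_of_vecMul_eq_zero hdetU hrow
    exact sub_eq_zero.mp h3
  have hPQ : P * Q = 1 := mul_eq_one_comm.mp hQP
  refine ⟨P, Q, hPQ, hQP, fun i j => ?_, fun i j hj => ?_, fun i => ?_⟩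
  · rw [hPU]; exact hHbox i j
  · rw [hPU]; exact hHtri i j hj
  · rw [hPU]; exact hHdiag i

/-- **The reduced saturated frame, triangular form kept**: p1's `exists_reduced_frame` plus `(P·U) i j = 0` for `j < i` and
`0 < (P·U) i i`. [cite: Cassels1997, Ch. I §2.2 Thm I] -/
theorem exists_reduced_frame_tri (a θ : Fin n → ℚ) (ha : ∀ j, a j ≠ 0) (hθ : ∀ i, 0 < θ i)
    (C U : Matrix (Fin n) (Fin n) ℤ) (N : ℕ) (hN : 0 < N)
    (hC : ∀ j, a j = ∏ i, θ i ^ C j i) (hU : ∀ i, θ i ^ N = ∏ j, a j ^ U i j)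
    (hCU : C * U = (N : ℤ) • (1 : Matrix (Fin n) (Fin n) ℤ))
    (hUC : U * C = (N : ℤ) • (1 : Matrix (Fin n) (Fin n) ℤ)) :
    ∃ (θ' : Fin n → ℚ) (P Q : Matrix (Fin n) (Fin n) ℤ),
      P * Q = 1 ∧ Q * P = 1 ∧ (∀ i, 0 < θ' i) ∧
      (∀ μ : Fin n → ℤ, ∏ i, θ' i ^ μ i = ∏ k, θ k ^ (μ ᵥ* P) k) ∧
      (∀ κ : Fin n → ℤ, ∏ k, θ k ^ κ k = ∏ i, θ' i ^ (κ ᵥ* Q) i) ∧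
      (∀ j, a j = ∏ i, θ' i ^ (C * Q) j i) ∧
      (∀ i, θ' i ^ N = ∏ j, a j ^ (P * U) i j) ∧
      (C * Q) * (P * U) = (N : ℤ) • (1 : Matrix (Fin n) (Fin n) ℤ) ∧
      (P * U) * (C * Q) = (N : ℤ) • (1 : Matrix (Fin n) (Fin n) ℤ) ∧
      (∀ i j, 0 ≤ (P * U) i j ∧ (P * U) i j ≤ N) ∧
      (∀ i j : Fin n, (j : ℕ) < i → (P * U) i j = 0) ∧ (∀ i, 0 < (P * U) i i) := by
  classical
  obtain ⟨P, Q, hPQ, hQP, hbox, htri, hdiag⟩ := exists_unimodular_reduce_tri N hN C U hCU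
  have hθ0 : ∀ i, θ i ≠ 0 := fun i => (hθ i).ne'
  -- the new system
  set θ' : Fin n → ℚ := fun i => ∏ k, θ k ^ P i k with hθ'
  have hθ'def : ∀ i, θ' i = ∏ k, θ k ^ P i k := fun i => rfl
  have hθ'pos : ∀ i, 0 < θ' i := fun i => Finset.prod_pos fun k _ => zpow_pos (hθ k) _
  -- transfer identities
  have htr1 : ∀ μ : Fin n → ℤ, ∏ i, θ' i ^ μ i = ∏ k, θ k ^ (μ ᵥ* P) k := fun μ => by
    rw [KummerBasisChange.prod_zpow_basisChange θ hθ0 (fun i k => P i k) θ' hθ'def μ]; rfl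
  have htr2 : ∀ κ : Fin n → ℤ, ∏ k, θ k ^ κ k = ∏ i, θ' i ^ (κ ᵥ* Q) i := fun κ => by
    rw [htr1 (κ ᵥ* Q), Matrix.vecMul_vecMul, hQP, Matrix.vecMul_one]
  refine ⟨θ', P, Q, hPQ, hQP, hθ'pos, htr1, htr2, fun j => ?_, fun i => ?_, ?_, ?_, hbox, htri, hdiag⟩
  · rw [hC j, htr2 (C j), row_mul_eq_vecMul]
  · have h1 : θ' i ^ N = ∏ k, (θ k ^ N) ^ P i k := by
      rw [hθ'def, ← Finset.prod_pow]
      refine Finset.prod_congr rfl fun k _ => ?_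
      rw [← zpow_natCast, ← zpow_natCast, ← _root_.zpow_mul, ← _root_.zpow_mul, mul_comm]
    rw [h1, KummerBasisChange.prod_zpow_basisChange a ha (fun k j => U k j) (fun k => θ k ^ N) hU (P i),
      row_mul_eq_vecMul]
    rfl
  · rw [Matrix.mul_assoc, ← Matrix.mul_assoc Q P, hQP, Matrix.one_mul, hCU]
  · rw [Matrix.mul_assoc, ← Matrix.mul_assoc U C, hUC, Matrix.smul_mul, Matrix.one_mul, Matrix.mul_smul, hPQ]

/-- **THE REDUCED SATURATION FRAME, UPPER-TRIANGULAR ROWS** (p1's `exists_reduced_satFrame` verbatim, plus `U i j = 0` for `j < i` and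
`0 < U i i`). [cite: Nesterenko2003, §3.4–3.5 and §4.3 Cor 4.5; Cassels1997, Ch. I §2.2] -/
theorem exists_reduced_satFrame_upper (α : Fin n → ℚ) (hα : ∀ j, 0 < α j)
    (hind : ∀ μ : Fin n → ℤ, ∏ j, α j ^ μ j = 1 → μ = 0) :
    ∃ (θ : Fin n → ℚ) (U C : Matrix (Fin n) (Fin n) ℤ) (N : ℕ),
      (∀ i, 0 < θ i) ∧
      (∀ μ : Fin n → ℤ, ∏ i, θ i ^ μ i = 1 → μ = 0) ∧
      (∀ q : ℕ, 0 < q → ∀ γ : ℚ, (∃ c : Fin n → ℤ, γ ^ q = ∏ i, θ i ^ c i) →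
        ∃ c : Fin n → ℤ, γ = ∏ i, θ i ^ c i ∨ -γ = ∏ i, θ i ^ c i) ∧
      (∀ κ : Fin n → ℤ, (∃ γ : ℚ, ∏ i, θ i ^ κ i = γ ^ 2 ∨ ∏ i, θ i ^ κ i = -γ ^ 2) →
        ∀ i, (2 : ℤ) ∣ κ i) ∧
      0 < N ∧
      (∀ i, θ i ^ N = ∏ j, α j ^ U i j) ∧
      (∀ j, α j = ∏ i, θ i ^ C j i) ∧
      U * C = (N : ℤ) • (1 : Matrix (Fin n) (Fin n) ℤ) ∧
      C * U = (N : ℤ) • (1 : Matrix (Fin n) (Fin n) ℤ) ∧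
      (N : ℤ) = |C.det| ∧
      (N : ℝ) ≤ ∏ j, (2 * Height.logHeight₁ (α j) / Real.log 2) ∧
      (∀ i j, 0 ≤ U i j ∧ U i j ≤ N) ∧
      (∀ j, ∑ i, |U i j| ≤ (n : ℤ) * N) ∧
      (∀ j k, |C j k| ≤ ((n - 1) ! : ℤ) * N) ∧
      (∀ i, Height.logHeight₁ (θ i) ≤ ∑ j, Height.logHeight₁ (α j)) ∧
      (∀ p : ℕ, p.Prime → (∀ j, padicValRat p (α j) = 0) → ∀ i, padicValRat p (θ i) = 0) ∧
      (∀ i j : Fin n, (j : ℕ) < i → U i j = 0) ∧ (∀ i, 0 < U i i) := by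
  classical
  have hα0 : ∀ j, α j ≠ 0 := fun j => (hα j).ne'
  have habs : ∀ j, |α j| = α j := fun j => abs_of_pos (hα j)
  obtain ⟨θ, C, U, N, hpos, hθind, hsat, hC, hNpos, hNdet, hNle, hU, -, -, -⟩ :=
    SatFrameKit.exists_satFrame α hα0 hind
  simp only [habs] at hC hU
  have hθ0 : ∀ i, θ i ≠ 0 := fun i => (hpos i).ne'
  have hUC : U * C = (N : ℤ) • (1 : Matrix (Fin n) (Fin n) ℤ) := mul_eq_smul_one_of_indep α θ hθ0 hθind C U N hC hU
  have hNz : (N : ℤ) ≠ 0 := by exact_mod_cast hNpos.ne'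
  have hCU : C * U = (N : ℤ) • (1 : Matrix (Fin n) (Fin n) ℤ) := mul_eq_smul_one_comm hNz hUC
  obtain ⟨θ', P, Q, hPQ, hQP, hθ'pos, htr1, htr2, hC', hU', hCU', hUC', hbox, htri, hdiag⟩ :=
    exists_reduced_frame_tri α θ hα0 hpos C U N hNpos hC hU hCU hUC
  have hθ'0 : ∀ i, θ' i ≠ 0 := fun i => (hθ'pos i).ne'
  -- independence of `θ'`
  have hθ'ind : ∀ μ : Fin n → ℤ, ∏ i, θ' i ^ μ i = 1 → μ = 0 := by
    intro μ hμ
    rw [htr1] at hμ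
    have h1 := hθind _ hμ
    have h2 : μ = (μ ᵥ* P) ᵥ* Q := by rw [Matrix.vecMul_vecMul, hPQ, Matrix.vecMul_one]
    rw [h2, h1, Matrix.zero_vecMul]
  -- `q`-saturation of `θ'`
  have hsat' : ∀ q : ℕ, 0 < q → ∀ γ : ℚ, (∃ c : Fin n → ℤ, γ ^ q = ∏ i, θ' i ^ c i) →
      ∃ c : Fin n → ℤ, γ = ∏ i, θ' i ^ c i ∨ -γ = ∏ i, θ' i ^ c i := by
    rintro q hq γ ⟨c, hc⟩
    rw [htr1] at hc
    obtain ⟨c', hc'⟩ := hsat q hq γ ⟨_, hc⟩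
    refine ⟨c' ᵥ* Q, ?_⟩
    rwa [← htr2]
  -- `2`-Kummer
  have hkum : ∀ κ : Fin n → ℤ, (∃ γ : ℚ, ∏ i, θ' i ^ κ i = γ ^ 2 ∨ ∏ i, θ' i ^ κ i = -γ ^ 2) →
      ∀ i, (2 : ℤ) ∣ κ i := by
    rintro κ ⟨γ, hγ⟩ i
    have hpos' : 0 < ∏ i, θ' i ^ κ i := Finset.prod_pos fun i _ => zpow_pos (hθ'pos i) _
    have hsq : ∏ i, θ' i ^ κ i = γ ^ 2 := by
      rcases hγ with h | h
      · exact h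
      · exfalso; have := sq_nonneg γ; linarith
    obtain ⟨c, hc⟩ := hsat' 2 two_pos γ ⟨κ, hsq.symm⟩
    have hγ2 : γ ^ 2 = ∏ i, θ' i ^ (2 * c i) := by
      have h' : γ ^ 2 = (∏ i, θ' i ^ c i) ^ 2 := by
        rcases hc with h | h
        · rw [← h]
        · rw [← h, neg_sq]
      rw [h', ← Finset.prod_pow]
      refine Finset.prod_congr rfl fun i _ => ?_
      rw [← zpow_natCast, ← _root_.zpow_mul, mul_comm]
      rfl
    have h1 : ∏ i, θ' i ^ (κ i - 2 * c i) = 1 := by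
      simp_rw [zpow_sub₀ (hθ'0 _)]
      rw [Finset.prod_div_distrib, ← hγ2, hsq, div_self (by rw [← hsq]; exact hpos'.ne')]
    have h2 := hθ'ind (fun i => κ i - 2 * c i) h1
    have h3 := congrFun h2 i
    simp only [Pi.zero_apply, sub_eq_zero] at h3
    exact ⟨c i, h3⟩
  -- `|det (C·Q)| = N`
  have hdetQ : |Q.det| = 1 := by
    have h := congrArg Matrix.det hPQ
    rw [Matrix.det_mul, Matrix.det_one, mul_comm] at h
    exact Int.isUnit_iff_abs_eq.mp (IsUnit.of_mul_eq_one _ h)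
  have hNdet' : (N : ℤ) = |(C * Q).det| := by rw [Matrix.det_mul, abs_mul, hdetQ, mul_one]; exact hNdet
  -- heights of `θ'`
  have hht : ∀ i, Height.logHeight₁ (θ' i) ≤ ∑ j, Height.logHeight₁ (α j) := by
    intro i
    have h := SatCoords.natCast_mul_logHeight₁_prod_zpow_le α θ' (P * U) N hα0 hU' (Pi.single i 1)
    have hs : ∏ k, θ' k ^ (Pi.single i (1 : ℤ) : Fin n → ℤ) k = θ' i := by
      rw [Finset.prod_eq_single i (fun k _ hk => by rw [Pi.single_eq_of_ne hk, zpow_zero]) (by simp),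
        Pi.single_eq_same, zpow_one]
    have hv : ∀ j, (Pi.single i (1 : ℤ) ᵥ* (P * U)) j = (P * U) i j := fun j => by
      simp [Matrix.vecMul, dotProduct, Pi.single_apply]
    rw [hs] at h
    simp_rw [hv] at h
    have hN' : (0 : ℝ) < N := by exact_mod_cast hNpos
    have h2 : ∑ j, (|(P * U) i j| : ℝ) * Height.logHeight₁ (α j) ≤ ∑ j, (N : ℝ) * Height.logHeight₁ (α j) := by
      refine Finset.sum_le_sum fun j _ => mul_le_mul_of_nonneg_right ?_ (Height.zero_le_logHeight₁ _)
      rw [abs_of_nonneg (by exact_mod_cast (hbox i j).1)]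
      exact_mod_cast (hbox i j).2
    rw [← Finset.mul_sum] at h2
    exact le_of_mul_le_mul_left (h.trans h2) hN'
  refine ⟨θ', P * U, C * Q, N, hθ'pos, hθ'ind, hsat', hkum, hNpos, hU', hC', hUC', hCU', hNdet', hNle, hbox,
    fun j => sum_abs_le_of_box hbox j,
    fun j k => abs_le_of_mul_eq_smul_one hNpos (C * Q) (P * U) hCU' hNdet'.symm hbox j k, hht, ?_, htri, hdiag⟩
  -- `p`-adic units stay units
  intro p hp hunit i
  haveI : Fact p.Prime := ⟨hp⟩
  have h1 : padicValRat p (θ' i ^ N) = 0 := by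
    rw [hU' i]; exact SatFrameKit.padicValRat_prod_zpow_eq_zero _ hα0 hunit _
  exact SatFrameKit.padicValRat_eq_zero_of_pow hNpos.ne' h1

end SatBasisReduced

end Summit.ABC.StewartYu
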